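import Literature.Analysis.Complex.PQTypes
import Literature.Analysis.Complex.DbarContraction
import HarnessLib

/-!
# How `θ ∧ ·`, `∂/∂z̄_v ⌟ ·` and derivatives change the pointwise `(p,q)`-type

Pointwise type bookkeeping for the operators of the flat `∂̄`-calculus
(`Literature/Analysis/Complex/PQTypes.lean`, `Literature/LinearAlgebra/Alternating/WedgeOne.lean`,
`Literature/Analysis/Complex/DbarContraction.lean`), Hörmander (1973), §2.1 / Voisin (2002),
§2.3.1:

* `IsOfTypeAt.wedgeOne_of_conj`: for a conjugate-linear `1`-form `θ` (e.g. `dz̄_j`),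
  `θ ∧ ·` maps type `(p,q)` to type `(p,q+1)`; `IsOfTypeAt.wedgeOne_of_linear`: for a
  complex-linear `θ` (e.g. `dz_j`), to type `(p+1,q)`;
* `IsOfTypeAt.dbarContract`: `∂/∂z̄_v ⌟ ·` maps type `(p,q+1)` to type `(p,q)`;
* `IsOfTypeAt.eq_zero_of_forall_dbarContract` (**positivity of the `dz̄`-degree**): a form of
  type `(p,q+1)` all of whose contractions `∂/∂z̄_v ⌟ η` vanish is zero (it is then `ℂ`-linear
  in every slot, i.e. of type `(k,0)`, Huybrechts Prop. 1.2.8, and `(k,0) ≠ (p,q+1)`);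
* `IsOfTypeAt.fderiv_apply`: derivatives of a form-valued function with values of type `(p,q)`
  have type `(p,q)` (a closed linear condition).

## References

* L. Hörmander, *An Introduction to Complex Analysis in Several Variables*, 2nd ed. (1973),
  §2.1. [HormanderSCV1973]
* C. Voisin, *Hodge Theory and Complex Algebraic Geometry I* (2002), §2.3.1. [Voisin2002]
* D. Huybrechts, *Complex Geometry* (2005), Prop. 1.2.8. [HuybrechtsCG2005]
-/

noncomputable section

open scoped ComplexConjugate
open Complex Function ContinuousAlternatingMap
open Literature.LinearAlgebra.Alternating

namespace Literature.Analysis.Complex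

variable {E : Type*} [NormedAddCommGroup E] [NormedSpace ℂ E] {n : ℕ}

/-! ### Rotations -/

/-- `conj (e^{iθ}) = e^{-iθ}`. [folklore] -/
theorem conj_exp_ofReal_mul_I (θ : ℝ) : conj (exp (θ * I)) = exp (-(θ * I)) := by
  rw [← exp_conj, map_mul, conj_ofReal, conj_I, mul_neg]

/-- `conj (e^{-iθ}) = e^{iθ}`. [folklore] -/
theorem conj_exp_neg_ofReal_mul_I (θ : ℝ) : conj (exp (-(θ * I))) = exp (θ * I) := by
  rw [← exp_conj, map_neg, map_mul, conj_ofReal, conj_I, mul_neg, neg_neg]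

/-- `e^{iθ} e^{-iθ} = 1`. [folklore] -/
theorem exp_mul_I_mul_exp_neg (θ : ℝ) : exp (θ * I) * exp (-(θ * I)) = 1 := by
  rw [← exp_add, add_neg_cancel, exp_zero]

/-! ### Wedge with a `1`-form -/

/-- **`θ ∧ ·` for a conjugate-linear `θ` raises `q`**: if `θ (c • w) = c̄ θ w` (e.g. `θ = dz̄_j`)
and `η` has pointwise type `(p,q)`, then `θ ∧ η` has type `(p,q+1)` (Hörmander (1973), §2.1:
`dz̄_j ∧` maps `(p,q)`-forms to `(p,q+1)`-forms). [cite: HormanderSCV1973, §2.1] -/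
theorem IsOfTypeAt.wedgeOne_of_conj {θ : E →L[ℝ] ℂ} (hθ : ∀ (c : ℂ) (w : E), θ (c • w) = conj c * θ w)
    {p q : ℕ} {η : E [⋀^Fin n]→L[ℝ] ℂ} (hη : IsOfTypeAt p q η) :
    IsOfTypeAt p (q + 1) (wedgeOne θ η) := by
  refine ⟨by have := hη.1; omega, fun θ' v => ?_⟩
  rw [wedgeOne_apply, wedgeOne_apply, Finset.mul_sum]
  refine Finset.sum_congr rfl fun i _ => ?_
  have h1 : θ (exp (θ' * I) • v i) = exp (-(θ' * I)) * θ (v i) := by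
    rw [hθ, conj_exp_ofReal_mul_I]
  have h2 : η (i.removeNth fun j => exp (θ' * I) • v j) =
      exp (((p : ℤ) - q : ℤ) * θ' * I) * η (i.removeNth v) := hη.2 θ' (i.removeNth v)
  rw [h1, h2]
  have h3 : exp (((p : ℤ) - (q + 1 : ℕ) : ℤ) * θ' * I) =
      exp (-(θ' * I)) * exp (((p : ℤ) - q : ℤ) * θ' * I) := by
    rw [← exp_add]; congr 1; push_cast; ring
  rw [h3]
  simp only [smul_eq_mul, zsmul_eq_mul]
  ring

/-- **`θ ∧ ·` for a complex-linear `θ` raises `p`**: if `θ (c • w) = c θ w` (e.g. `θ = dz_j`) and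
`η` has pointwise type `(p,q)`, then `θ ∧ η` has type `(p+1,q)`. [cite: HormanderSCV1973, §2.1] -/
theorem IsOfTypeAt.wedgeOne_of_linear {θ : E →L[ℝ] ℂ} (hθ : ∀ (c : ℂ) (w : E), θ (c • w) = c * θ w)
    {p q : ℕ} {η : E [⋀^Fin n]→L[ℝ] ℂ} (hη : IsOfTypeAt p q η) :
    IsOfTypeAt (p + 1) q (wedgeOne θ η) := by
  refine ⟨by have := hη.1; omega, fun θ' v => ?_⟩
  rw [wedgeOne_apply, wedgeOne_apply, Finset.mul_sum]
  refine Finset.sum_congr rfl fun i _ => ?_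
  have h2 : η (i.removeNth fun j => exp (θ' * I) • v j) =
      exp (((p : ℤ) - q : ℤ) * θ' * I) * η (i.removeNth v) := hη.2 θ' (i.removeNth v)
  rw [hθ, h2]
  have h3 : exp ((((p + 1 : ℕ) : ℤ) - q : ℤ) * θ' * I) =
      exp (θ' * I) * exp (((p : ℤ) - q : ℤ) * θ' * I) := by
    rw [← exp_add]; congr 1; push_cast; ring
  rw [h3]
  simp only [smul_eq_mul, zsmul_eq_mul]
  ring

/-! ### Contraction with `∂/∂z̄_v` -/

-- Real-linearity of a form `η : E [⋀^Fin (n + 1)]→L[ℝ] ℂ` in its first slot is Mathlib's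
-- `ContinuousAlternatingMap.vecCons_add` / `ContinuousAlternatingMap.vecCons_smul` (used below).

/-- **The `∂/∂z̄_v`-contraction formula is conjugate-homogeneous in `v`**:
`η(c v, u) + i η(i c v, u) = c̄ (η(v, u) + i η(iv, u))`. [folklore] -/
theorem map_vecCons_smul_add_I (η : E [⋀^Fin (n + 1)]→L[ℝ] ℂ) (c : ℂ) (w : E) (u : Fin n → E) :
    η (Matrix.vecCons (c • w) u) + I * η (Matrix.vecCons (I • (c • w)) u) =
      conj c * (η (Matrix.vecCons w u) + I * η (Matrix.vecCons (I • w) u)) := by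
  have hc : c • w = (c.re : ℝ) • w + (c.im : ℝ) • (I • w) := by
    rw [← Complex.coe_smul, ← Complex.coe_smul, smul_smul, ← add_smul, re_add_im]
  have hIc : I • (c • w) = (c.re : ℝ) • (I • w) + (-c.im : ℝ) • w := by
    rw [hc, smul_add, smul_comm I (c.re : ℝ) w, smul_comm I (c.im : ℝ) (I • w), smul_smul, I_mul_I,
      neg_one_smul, smul_neg, ← neg_smul]
  rw [hIc, hc, vecCons_add, vecCons_smul, vecCons_smul, vecCons_add, vecCons_smul, vecCons_smul]
  simp only [real_smul, ofReal_neg]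
  have hconj : conj c = (c.re : ℂ) - (c.im : ℂ) * I := by
    apply Complex.ext <;> simp
  rw [hconj]
  linear_combination ((c.im : ℂ) * η (Matrix.vecCons (I • w) u)) * I_mul_I

/-- **`∂/∂z̄_v ⌟ ·` lowers `q`**: if `η` has pointwise type `(p,q+1)` then `∂/∂z̄_v ⌟ η` has type
`(p,q)` (Hörmander (1973), §2.1: the coefficients `g` of `dz̄_k` in a `(p,q+1)`-form form a
`(p,q)`-form). [cite: HormanderSCV1973, §2.1] -/
theorem IsOfTypeAt.dbarContract (v : E) {p q : ℕ} {η : E [⋀^Fin (n + 1)]→L[ℝ] ℂ}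
    (hη : IsOfTypeAt p (q + 1) η) : IsOfTypeAt p q (dbarContract v η) := by
  refine ⟨by have := hη.1; omega, fun θ' u => ?_⟩
  set R : ℂ := exp (θ' * I) with hR
  set R' : ℂ := exp (-(θ' * I)) with hR'
  have key : ∀ w : E, η (Matrix.vecCons w fun i => R • u i) =
      exp (((p : ℤ) - (q + 1 : ℕ) : ℤ) * θ' * I) * η (Matrix.vecCons (R' • w) u) := by
    intro w
    have h := hη.2 θ' (Matrix.vecCons (R' • w) u)
    have hv : (fun i => exp (θ' * I) • Matrix.vecCons (R' • w) u i) =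
        Matrix.vecCons w fun i => R • u i := by
      ext i
      refine Fin.cases ?_ (fun j => ?_) i
      · simp [hR', smul_smul, exp_mul_I_mul_exp_neg]
      · simp [hR]
    rwa [hv] at h
  rw [dbarContract_apply, dbarContract_apply, key v, key (I • v), smul_comm R' I v]
  have hm := map_vecCons_smul_add_I η R' v u
  have hcR' : conj R' = exp (θ' * I) := by rw [hR', conj_exp_neg_ofReal_mul_I]
  rw [hcR'] at hm
  have h3 : exp (((p : ℤ) - (q + 1 : ℕ) : ℤ) * θ' * I) * exp (θ' * I) =
      exp (((p : ℤ) - q : ℤ) * θ' * I) := by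
    rw [← exp_add]; congr 1; push_cast; ring
  rw [← h3]
  simp only [smul_eq_mul]
  linear_combination ((2 : ℂ)⁻¹ * exp (((p : ℤ) - (q + 1 : ℕ) : ℤ) * θ' * I)) * hm

/-! ### Positivity of the `dz̄`-degree -/

/-- From `∂/∂z̄_w ⌟ η = 0`: `η(iw, u) = i η(w, u)`. [folklore] -/
theorem map_vecCons_I_smul_of_dbarContract_eq_zero {η : E [⋀^Fin (n + 1)]→L[ℝ] ℂ} {w : E}
    (h : dbarContract w η = 0) (u : Fin n → E) :
    η (Matrix.vecCons (I • w) u) = I * η (Matrix.vecCons w u) := by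
  have h1 : (2 : ℂ)⁻¹ • (η (Matrix.vecCons w u) + I • η (Matrix.vecCons (I • w) u)) = 0 := by
    rw [← dbarContract_apply, h]; rfl
  have h2 : η (Matrix.vecCons w u) + I * η (Matrix.vecCons (I • w) u) = 0 := by
    have := (smul_eq_zero.mp h1).resolve_left (inv_ne_zero two_ne_zero)
    simpa only [smul_eq_mul] using this
  linear_combination (-I) * h2 + η (Matrix.vecCons (I • w) u) * I_mul_I

/-- From `∂/∂z̄_w ⌟ η = 0` for all `w`: `η` is `ℂ`-linear in its first slot. [folklore] -/
theorem map_vecCons_smul_of_forall_dbarContract_eq_zero {η : E [⋀^Fin (n + 1)]→L[ℝ] ℂ}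
    (h : ∀ w, dbarContract w η = 0) (c : ℂ) (w : E) (u : Fin n → E) :
    η (Matrix.vecCons (c • w) u) = c * η (Matrix.vecCons w u) := by
  have hc : c • w = (c.re : ℝ) • w + (c.im : ℝ) • (I • w) := by
    rw [← Complex.coe_smul, ← Complex.coe_smul, smul_smul, ← add_smul, re_add_im]
  rw [hc, vecCons_add, vecCons_smul, vecCons_smul, map_vecCons_I_smul_of_dbarContract_eq_zero (h w)]
  simp only [real_smul]
  conv_rhs => rw [← re_add_im c]
  ring

/-- From `∂/∂z̄_w ⌟ η = 0` for all `w`: `η` is `ℂ`-linear in every slot (alternation moves the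
slot to the front). [folklore] -/
theorem map_update_smul_of_forall_dbarContract_eq_zero {η : E [⋀^Fin (n + 1)]→L[ℝ] ℂ}
    (h : ∀ w, dbarContract w η = 0) (v : Fin (n + 1) → E) (j : Fin (n + 1)) (c : ℂ) :
    η (update v j (c • v j)) = c * η v := by
  have h0 : ∀ v : Fin (n + 1) → E, η (update v 0 (c • v 0)) = c * η v := fun v => by
    conv_lhs => rw [← Fin.cons_self_tail v, Fin.update_cons_zero]
    conv_rhs => rw [← Fin.cons_self_tail v]
    exact map_vecCons_smul_of_forall_dbarContract_eq_zero h c (v 0) (Fin.tail v)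
  by_cases hj : j = 0
  · subst hj; exact h0 v
  · have hswap : update v j (c • v j) ∘ Equiv.swap 0 j = update (v ∘ Equiv.swap 0 j) 0 (c • v j) := by
      have := update_comp_eq_of_injective v (Equiv.swap (0 : Fin (n + 1)) j).injective 0 (c • v j)
      rwa [Equiv.swap_apply_left] at this
    have h1 : η (update v j (c • v j) ∘ Equiv.swap 0 j) = -η (update v j (c • v j)) :=
      η.toAlternatingMap.map_swap _ (Ne.symm hj)
    have h2 : η (v ∘ Equiv.swap 0 j) = -η v := η.toAlternatingMap.map_swap _ (Ne.symm hj)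
    have h3 := h0 (v ∘ Equiv.swap 0 j)
    simp only [comp_apply, Equiv.swap_apply_left] at h3
    rw [← hswap, h1, h2] at h3
    linear_combination -h3

/-- **Positivity of the `dz̄`-degree** ("every term in `f` is of degree `q+1 > 0` with respect
to `dz̄`", Hörmander (1973), proof of Thm. 2.3.3): a form of pointwise type `(p,q+1)` whose
contractions `∂/∂z̄_w ⌟ η` all vanish is zero. Indeed it is then `ℂ`-linear in every slot, hence
of type `(k,0)` (Huybrechts, Prop. 1.2.8), and `(k,0) ≠ (p,q+1)`. [cite: HormanderSCV1973, Thm. 2.3.3] -/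
theorem IsOfTypeAt.eq_zero_of_forall_dbarContract {p q : ℕ} {η : E [⋀^Fin (n + 1)]→L[ℝ] ℂ}
    (hη : IsOfTypeAt p (q + 1) η)
    (h : ∀ w, Literature.Analysis.Complex.dbarContract w η = 0) : η = 0 :=
  hη.eq_zero_of_isOfTypeAt_of_ne
    (isOfTypeAt_of_forall_update_smul (map_update_smul_of_forall_dbarContract_eq_zero h))
    (Or.inr (Nat.succ_ne_zero q))

/-! ### Derivatives -/

section Deriv

variable {X : Type*} [NormedAddCommGroup X] [NormedSpace ℝ X] {k : ℕ}

-- Derivatives commute with evaluation at a fixed tuple: this is Mathlib's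
-- `fderiv_continuousAlternatingMap_apply_const_apply`.

/-- **Derivatives preserve the pointwise type**: if all values of `α` have type `(p,q)` and `α`
is differentiable at `x`, then `Dα(x)[w]` has type `(p,q)` (type `(p,q)` is a closed linear
condition; so `∂/∂z̄_j`, `∂/∂z_j` act on `(p,q)`-forms coefficientwise, Hörmander (1973), §2.1).
[cite: HormanderSCV1973, §2.1] -/
theorem IsOfTypeAt.fderiv_apply {p q : ℕ} {α : X → E [⋀^Fin k]→L[ℝ] ℂ} {x : X}
    (hα : ∀ y, IsOfTypeAt p q (α y)) (hd : DifferentiableAt ℝ α x) (w : X) :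
    IsOfTypeAt p q (fderiv ℝ α x w) := by
  refine ⟨(hα x).1, fun θ v => ?_⟩
  have h1 : (fun y => α y fun i => exp (θ * I) • v i) =
      fun y => exp (((p : ℤ) - q : ℤ) * θ * I) * α y v := funext fun y => (hα y).2 θ v
  have hA : HasFDerivAt (fun y => α y fun i => exp (θ * I) • v i)
      ((ContinuousAlternatingMap.apply ℝ E ℂ fun i => exp (θ * I) • v i).comp (fderiv ℝ α x)) x :=
    (ContinuousAlternatingMap.apply ℝ E ℂ fun i => exp (θ * I) • v i).hasFDerivAt.comp x
      hd.hasFDerivAt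
  have hB : HasFDerivAt (fun y => exp (((p : ℤ) - q : ℤ) * θ * I) * α y v)
      (exp (((p : ℤ) - q : ℤ) * θ * I) • (ContinuousAlternatingMap.apply ℝ E ℂ v).comp
        (fderiv ℝ α x)) x :=
    ((ContinuousAlternatingMap.apply ℝ E ℂ v).hasFDerivAt.comp x hd.hasFDerivAt).const_mul _
  rw [← h1] at hB
  have h2 := congr_arg (fun L : X →L[ℝ] ℂ => L w) (hA.unique hB)
  simpa using h2

end Deriv

end Literature.Analysis.Complex
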